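import Summits.BirchSwinnertonDyer.Rank1Residual.Additive.X4RankZeroCoveredLocusManinFree
import Summits.BirchSwinnertonDyer.Rank1Residual.Additive.X4RankZeroKatoBoundTamagawaExact
import Summits.BirchSwinnertonDyer.Rank1Residual.Additive.N10IsogenyTransport
import Summits.BirchSwinnertonDyer.Rank1Residual.Supersingular.DescentLowerBound
import HarnessLib

/-!
# Route `AdditiveBranchIMC` (rung K1), crux `GordTwoRankZeroOffCaseOne` (item 19357): the rank-ZERO `p`-DESCENT door at an additive `p ≥ 5` —
# X4 ∧ surj(p) ∧ `ord_p #Ш_an ≤ 2` rows close from ONE nonzero `p`-Selmer element (cell `bsd-addord`, seat `bsd-addord-k1-c2` gen 8; the `p ≥ 5`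
# twin of the `p = 3` desc3 doors p515502 / p521298 / p529837)

HONEST FRAMING. THEOREMS ONLY: no definition, no named fact, no `sorry`, nothing booked; BSD is not proved by any of this; the crux stays OPEN at
class level. Pure composition of tree theorems: UPPER half = additive-p4 V34's Manin-free covered locus at `p ≥ 5`
(`X4RankZero.missingUpperBoundAt_of_facts_of_five_le_maninFree`: Kato 2004 Thm. 14.5 (3) in the Manin-free SHARP reading A161′ on the potentially
good branch — tower by Serre, Tamagawa certificate `p ∤ ∏ c_ℓ` ALONE at an additive `p ≥ 5` (Kodaira–Néron: `c_p ≤ 4`) —, Delbourgo 1998 Prop. 4 +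
Kato's half-eigen divisibility on the (M) branch with no Tamagawa datum), its parity enlargement (`…_of_katoManinFree_of_casselsTate_of_tamDefect_le_one_of_even`:
`p² ∤ ∏ c_ℓ` when `ord_p #Ш_an` is even) and the Tamagawa-exact reading A161″ = A305 (`X4RankZero.missingUpperBoundAt_of_katoTam`, no Tamagawa binder);
LOWER half = the class-free certificate line `Sel^(p)(E/ℚ) ≠ 0` (`Supersingular.missingLowerBoundAt_of_casselsTate_of_selmerGroup_ne_bot`: rank `0` by
GZK, `E[p]` irreducible ⟹ no rational `p`-torsion, Cassels–Tate ⟹ `p² ∣ #Ш` ⟹ `ord_p #Ш_an ≤ 2 ≤ ord_p #Ш`). CLIENTELE (census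
`HOME/k1-c2/g8/K1C2G8-TAMDEFECT-OFFSTRATUM.md` §5 on A R704): the ≈ 720 X4 ∧ `r_an = 0` ∧ surj(p) ∧ `ord_p #Ш_an = 2` residue cells at `p ≥ 5`
((5,M) 188 · (5,e=6) 143 · (5,e=3) 117 · (5,e=4) 74 · (7,M) 58 · (7,e=6) 38 · (7,e=3) 26 · (5,e=2) 23 · …), ALL with `p ∤ ∏ c_ℓ`: the ONLY missing
input per pair is ONE nonzero element of `Sel^(p)(E/ℚ)` — from a `p`-descent (unit b2b-bsdres-x11c GEN 14 `x5desc` in element mode), a Selmer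
companion (Mazur–Rubin 2015), or a visible element (Cremona–Mazur). Per pair; nothing booked here.
References: [Kato2004Asterisque] Thm. 14.5 (3) (p. 236), Prop. 14.16 (2) (p. 244), §14.8 (p. 238), Thm. 17.4 (3) (p. 273); [GreenbergLNM1716] §4 Prop.
4.13; [Delbourgo1998] Prop. 4 (p. 144); [Serre1972] IV §3.4; [SilvermanATAEC1994] Cor. IV.9.2 (d); [SilvermanAEC2009] Thm. X.4.14; [MilneADT2006]
Thm. I.7.3; [Miller2011LMS] Def. 1.1.
-/

noncomputable section

open scoped Classical

open WeierstrassCurve Literature.NumberTheory.EllipticCurves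
  Literature.NumberTheory.EllipticCurves.ModularForms
  Literature.NumberTheory.EllipticCurves.Rank1Residual
  Literature.NumberTheory.EllipticCurves.Rank1Residual.Typed
  Literature.NumberTheory.GaloisRepresentations

set_option linter.dupNamespace false
set_option autoImplicit false

namespace Summit.BirchSwinnertonDyer.BirchSwinnertonDyer.Theorems.AdditiveBranchIMCGordTwoRankZeroDescP

open Summit.BirchSwinnertonDyer.Rank1Residual
open Summit.BirchSwinnertonDyer.Rank1Residual.Additive

variable (W : WeierstrassCurve ℚ) [W.IsElliptic] [W.IsGloballyMinimal] (p : ℕ) [Fact p.Prime]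

/-! ### §1 Tamagawa certificate `p ∤ ∏ c_ℓ` (every potentially good row) / nothing on the (M) branch -/

/-- **`BSD(E,p)`, `p ≥ 5`, on an X4 ∧ surj(p) row with `ord_p #Ш_an ≤ 2` from ONE nonzero `p`-Selmer element**: binders {hKato = A161′ Manin-free,
hDel, hGZK, hmod, hmodD, hKatoχ, hCT} + row data (`5 ≤ p`, `r_an = 0`, `ClassX4 W p`, surj(p), `hcov : ord_p j < 0 ∨ p ∤ ∏ c_ℓ`, `#Ш_an = q` with
`ord_p q ≤ 2`) + the certificate line `hSel : Sel^(p)(E/ℚ) ≠ 0`. Upper half = `X4RankZero.missingUpperBoundAt_of_facts_of_five_le_maninFree`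
(tower by Serre; no image certificate beyond surj(p)); lower half = `Supersingular.missingLowerBoundAt_of_casselsTate_of_selmerGroup_ne_bot`.
The `p ≥ 5` twin of p521298 `…Desc3.bsdp_three_of_x4Cert_of_selmerGroup_ne_bot_maninFree`. Per pair; nothing booked here.
[cite: Kato2004Asterisque, Thm. 14.5 (3) (p. 236), Thm. 17.4 (3) (p. 273)] [cite: Delbourgo1998, Prop. 4 (p. 144)] [cite: Serre1972, IV §3.4]
[cite: SilvermanAEC2009, Thm. X.4.14] [cite: Miller2011LMS, §1 and Def. 1.1] -/
theorem bsdp_of_x4_of_selmerGroup_ne_bot_of_five_le_maninFree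
    (hKato : Kato2004.rankZero_padicValNat_sha_le_sub_localTamagawa_of_additive_potGood_of_imageContainsSL2_maninFree)
    (hDel : Delbourgo1998.prop4_rankZero_pow_dvd_constantCoeff)
    (hGZK : rank_eq_analyticRank_of_analyticRank_le_one) (hmod : hasEntireLFunction_rat)
    (hmodD : nonempty_modularParametrizationData)
    (hKatoχ : Wuthrich2014.kato_halfEigenCharIdeal_dvd_cyclotomicPrime_of_surjective)
    (hCT : exists_casselsTate_pairing (K := ℚ))
    (hp5 : 5 ≤ p) (hr : W.analyticRank = 0) (hX : ClassX4 W p) (hsurj : Surj W p)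
    (hcov : padicValRat p W.j < 0 ∨ ¬ p ∣ W.tamagawaProduct)
    {q : ℚ} (hq : shaAn W = (q : ℂ)) (hv : padicValRat p q ≤ 2) (hSel : W.selmerGroup (p : ℤ) ≠ ⊥) : BSDp W p :=
  bsdp_of_missingPPartAt W p hGZK (by rw [hr]; exact zero_le_one)
    (missingPPartAt_of_lower_of_upper W p
      (Supersingular.missingLowerBoundAt_of_casselsTate_of_selmerGroup_ne_bot W p hCT hGZK hr
        (Supersingular.not_dvd_torsionOrder_of_irr W p hX.2.2) hq hv hSel)
      (X4RankZero.missingUpperBoundAt_of_facts_of_five_le_maninFree W p hKato hDel hGZK hmod hmodD hKatoχ hp5 hr hX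
        hsurj hcov))

/-- **ISOGENY-CLASS form** of `bsdp_of_x4_of_selmerGroup_ne_bot_of_five_le_maninFree` (Cassels `hCassels`).
[cite: MilneADT2006, Thm. I.7.3 and Remark I.7.4] [cite: Kato2004Asterisque, Thm. 14.5 (3) (p. 236)] [cite: Miller2011LMS, §1 and Def. 1.1] -/
theorem isogenous_bsdp_of_x4_of_selmerGroup_ne_bot_of_five_le_maninFree
    (hCassels : bsdRHS_eq_of_isIsogenous)
    (hKato : Kato2004.rankZero_padicValNat_sha_le_sub_localTamagawa_of_additive_potGood_of_imageContainsSL2_maninFree)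
    (hDel : Delbourgo1998.prop4_rankZero_pow_dvd_constantCoeff)
    (hGZK : rank_eq_analyticRank_of_analyticRank_le_one) (hmod : hasEntireLFunction_rat)
    (hmodD : nonempty_modularParametrizationData)
    (hKatoχ : Wuthrich2014.kato_halfEigenCharIdeal_dvd_cyclotomicPrime_of_surjective)
    (hCT : exists_casselsTate_pairing (K := ℚ))
    {W' : WeierstrassCurve ℚ} [W'.IsElliptic] [W'.IsGloballyMinimal] (hiso : IsIsogenous W' W)
    (hp5 : 5 ≤ p) (hr : W.analyticRank = 0) (hX : ClassX4 W p) (hsurj : Surj W p)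
    (hcov : padicValRat p W.j < 0 ∨ ¬ p ∣ W.tamagawaProduct)
    {q : ℚ} (hq : shaAn W = (q : ℂ)) (hv : padicValRat p q ≤ 2) (hSel : W.selmerGroup (p : ℤ) ≠ ⊥) : BSDp W' p := by
  have hr' : W'.analyticRank ≤ 1 := by rw [analyticRank_eq_of_isIsogenous' hiso, hr]; exact zero_le_one
  exact N10.bsdp_of_isIsogenous_of_bsdp p hCassels hGZK hmod hiso hr'
    (bsdp_of_x4_of_selmerGroup_ne_bot_of_five_le_maninFree W p hKato hDel hGZK hmod hmodD hKatoχ hCT hp5 hr hX hsurj hcov hq hv hSel)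

/-! ### §2 Tamagawa defect one with Cassels–Tate parity (potentially good rows, `p² ∤ ∏ c_ℓ`, `ord_p #Ш_an` even) -/

/-- **`BSD(E,p)`, `p ≥ 5`, potentially good X4 row with `p ∥ ∏ c_ℓ` allowed** (`p² ∤ ∏ c_ℓ`, i.e. Tamagawa defect `≤ 1` since `c_p ≤ 4`), `#Ш_an = q`
with `ord_p q ≤ 2` EVEN, and ONE nonzero `p`-Selmer element: upper half = additive-p4's `X4RankZero.missingUpperBoundAt_of_katoManinFree_of_casselsTate_of_tamDefect_le_one_of_even`
(Kato SHARP + Cassels–Tate squareness; tower by Serre). Per pair; nothing booked here. [cite: Kato2004Asterisque, Thm. 14.5 (3) (p. 236), Prop. 14.16 (2) (p. 244)]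
[cite: Serre1972, IV §3.4] [cite: SilvermanATAEC1994, Cor. IV.9.2 (d) (PDF p. 340)] [cite: SilvermanAEC2009, Thm. X.4.14] [cite: Miller2011LMS, §1 and Def. 1.1] -/
theorem bsdp_of_x4_potGood_of_selmerGroup_ne_bot_of_tamDefect_le_one_of_even_of_five_le
    (hCT : exists_casselsTate_pairing (K := ℚ))
    (hKato : Kato2004.rankZero_padicValNat_sha_le_sub_localTamagawa_of_additive_potGood_of_imageContainsSL2_maninFree)
    (hGZK : rank_eq_analyticRank_of_analyticRank_le_one) (hmod : hasEntireLFunction_rat)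
    (hp5 : 5 ≤ p) (hr : W.analyticRank = 0) (hX : ClassX4 W p) (hpot : 0 ≤ padicValRat p W.j) (hsurj : Surj W p)
    (htam : ¬ p ^ 2 ∣ W.tamagawaProduct)
    {q : ℚ} (hq : shaAn W = (q : ℂ)) (hv : padicValRat p q ≤ 2) (heven : Even (padicValRat p q))
    (hSel : W.selmerGroup (p : ℤ) ≠ ⊥) : BSDp W p := by
  have htam' : padicValNat p W.tamagawaProduct ≤
      padicValNat p ((W.baseChange ℚ_[p]).localTamagawaNumber ℤ_[p]) + 1 := by
    rw [padicValNat_localTamagawaNumber_padic_eq_zero_of_addv W p hX.2.1 hp5, zero_add]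
    exact padicValNat_le_one_of_not_sq_dvd (W.tamagawaProduct_pos_holds).ne' htam
  exact bsdp_of_missingPPartAt W p hGZK (by rw [hr]; exact zero_le_one)
    (missingPPartAt_of_lower_of_upper W p
      (Supersingular.missingLowerBoundAt_of_casselsTate_of_selmerGroup_ne_bot W p hCT hGZK hr
        (Supersingular.not_dvd_torsionOrder_of_irr W p hX.2.2) hq hv hSel)
      (X4RankZero.missingUpperBoundAt_of_katoManinFree_of_casselsTate_of_tamDefect_le_one_of_even W p hCT hKato hGZK
        hmod hr hX hpot (towerSurj_of_surj_of_ne_three W p hX hsurj (by omega)) htam' hq heven))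

/-! ### §3 No Tamagawa binder: the Tamagawa-exact reading A161″ = A305 (potentially good rows) -/

/-- **`BSD(E,p)`, `p ≥ 5`, potentially good X4 ∧ surj(p) row with `ord_p #Ш_an ≤ 2`, NO Tamagawa binder**, from ONE nonzero `p`-Selmer element, on the
Tamagawa-EXACT reading hKatoT = A161″ (b2b registry A305; Kato Thm. 14.5 (3) + Prop. 14.16 (2) + §14.8 with Greenberg LNM 1716 Prop. 4.13):
upper half = n1011's `X4RankZero.missingUpperBoundAt_of_katoTam`. Per pair; nothing booked here. [cite: Kato2004Asterisque, Thm. 14.5 (3) (p. 236), Prop. 14.16 (2) (p. 244), §14.8 (p. 238)]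
[cite: GreenbergLNM1716, §4 Prop. 4.13] [cite: Serre1972, IV §3.4] [cite: SilvermanAEC2009, Thm. X.4.14] [cite: Miller2011LMS, §1 and Def. 1.1] -/
theorem bsdp_of_x4_potGood_of_selmerGroup_ne_bot_katoTam_of_five_le
    (hKatoT : Kato2004.rankZero_padicValNat_sha_add_padicValNat_tamagawa_le_of_additive_potGood_of_imageContainsSL2)
    (hCT : exists_casselsTate_pairing (K := ℚ))
    (hGZK : rank_eq_analyticRank_of_analyticRank_le_one) (hmod : hasEntireLFunction_rat)
    (hp5 : 5 ≤ p) (hr : W.analyticRank = 0) (hX : ClassX4 W p) (hpot : 0 ≤ padicValRat p W.j) (hsurj : Surj W p)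
    {q : ℚ} (hq : shaAn W = (q : ℂ)) (hv : padicValRat p q ≤ 2) (hSel : W.selmerGroup (p : ℤ) ≠ ⊥) : BSDp W p :=
  X4RankZero.bsdp_of_missingLowerBoundAt_of_katoTam W p hKatoT hGZK hmod hr hX hpot
    (towerSurj_of_surj_of_ne_three W p hX hsurj (by omega))
    (Supersingular.missingLowerBoundAt_of_casselsTate_of_selmerGroup_ne_bot W p hCT hGZK hr
      (Supersingular.not_dvd_torsionOrder_of_irr W p hX.2.2) hq hv hSel)

end Summit.BirchSwinnertonDyer.BirchSwinnertonDyer.Theorems.AdditiveBranchIMCGordTwoRankZeroDescP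

end
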